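import Summits.QuantumFields.YangMills.Theorems.ColdStartUniversalityLatticeLangevinGradientDriftPlaquette
import Mathlib.Analysis.Calculus.ContDiff.Basic
import Mathlib.Analysis.Calculus.Deriv.Comp
import Mathlib.Analysis.Complex.RealDeriv
import HarnessLib

/-!
# Route `ColdStartUniversality`, crux K_A1 `UniformColdStartMixing` (stmt-QuantumFields-24809), rung `stub_fixedCutoffMixing`:
# G-block, brick G1b (flat coordinates, part 1) — the plaquette function in the real link coordinates

Helper file (seat `ym-line-csu-p1`, g7).  The plaquette function `ψ̃(Q) = β Σ_p Re tr(rootedLoop Q p false)` read in the real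
link coordinates `y = (Re/Im Q_e(i,j))` of `dynkin_expectation_szz` (links rebuilt as `y(e,i,j,ff) + y(e,i,j,tt)·I`):
* `rebuild_flat` / `flat_add_real_smul` — rebuilding the links from their coordinates, linearity of the coordinates;
* an entrywise `ContDiff` toolkit for matrix-valued functions of the coordinates and `contDiff_psiHat` — `ψ̂` is smooth;
* `hasDerivAt_psiHat_flat_line` / `fderiv_psiHat_flat_noise` — the derivative of `ψ̂` at `flat Q` in the direction of the
  coordinates of the noise field `δ_e σ_{e,n}(Q)` is `β Σ_{j ≠ e.2} Σ_b Re tr((√2 𝐩E_n) · rootedLoop Q e j b)`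
  (`hasDerivAt_sum_re_trace_plaquette`, uniqueness of derivatives).
No definition, no sorry.  RECORD-rung R3 plumbing; nothing here bears on the mass gap.
-/

set_option autoImplicit false

noncomputable section

namespace Summit.QuantumFields.YangMills.Theorems.ColdStartUniversality

open Finset Matrix Complex
open scoped BigOperators Matrix ComplexConjugate
open Literature.MathematicalPhysics.QuantumFieldTheory

/-! ### Coordinates and rebuilding -/

/-- Rebuilding the links from their real coordinates: `(Re z) + (Im z) I = z` entrywise. [folklore] -/
theorem rebuild_flat {d L N : ℕ} (Q : MatrixConfig d L N) :
    (fun (e : Edge d L) (i j : Fin N) =>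
      (((fun q : Edge d L × Fin N × Fin N × Bool => (fun z : ℂ => if q.2.2.2 then z.im else z.re) (Q q.1 q.2.1 q.2.2.1))
          (e, i, j, false) : ℝ) : ℂ) +
        (((fun q : Edge d L × Fin N × Fin N × Bool => (fun z : ℂ => if q.2.2.2 then z.im else z.re) (Q q.1 q.2.1 q.2.2.1))
          (e, i, j, true) : ℝ) : ℂ) * Complex.I) = Q := by
  funext e i j
  simp only [Bool.false_eq_true, ↓reduceIte]
  exact Complex.re_add_im (Q e i j)

/-- The coordinates are real-linear along lines: `flat(Q + s D) = flat Q + s • flat D`. [folklore] -/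
theorem flat_add_real_smul {d L N : ℕ} (Q D : MatrixConfig d L N) (s : ℝ) :
    (fun q : Edge d L × Fin N × Fin N × Bool => (fun z : ℂ => if q.2.2.2 then z.im else z.re)
        ((Q q.1 + (s : ℂ) • D q.1) q.2.1 q.2.2.1)) =
      (fun q : Edge d L × Fin N × Fin N × Bool => (fun z : ℂ => if q.2.2.2 then z.im else z.re) (Q q.1 q.2.1 q.2.2.1)) +
        s • (fun q : Edge d L × Fin N × Fin N × Bool => (fun z : ℂ => if q.2.2.2 then z.im else z.re) (D q.1 q.2.1 q.2.2.1)) := by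
  funext q
  rcases q with ⟨e, i, j, c⟩
  simp only [Matrix.add_apply, Matrix.smul_apply, smul_eq_mul, Pi.add_apply, Pi.smul_apply]
  cases c
  · simp [Complex.add_re, Complex.mul_re]
  · simp [Complex.add_im, Complex.mul_im]

/-! ### Entrywise smoothness of matrix-valued functions of the coordinates -/

/-- The rebuilt link entries are smooth functions of the coordinates. [folklore] -/
theorem contDiff_entry_rebuild {d L N : ℕ} [NeZero L] {n : WithTop ℕ∞} (e : Edge d L) (a b : Fin N) :
    ContDiff ℝ n fun y : Edge d L × Fin N × Fin N × Bool → ℝ =>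
      ((y (e, a, b, false) : ℝ) : ℂ) + ((y (e, a, b, true) : ℝ) : ℂ) * Complex.I :=
  (Complex.ofRealCLM.contDiff.comp (contDiff_apply ℝ ℝ (e, a, b, false))).add
    ((Complex.ofRealCLM.contDiff.comp (contDiff_apply ℝ ℝ (e, a, b, true))).mul contDiff_const)

/-- Products, entrywise. [folklore] -/
theorem contDiff_entry_mul {E : Type*} [NormedAddCommGroup E] [NormedSpace ℝ E] {N : ℕ} {n : WithTop ℕ∞}
    {M P : E → Matrix (Fin N) (Fin N) ℂ} (hM : ∀ a b, ContDiff ℝ n fun y => M y a b)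
    (hP : ∀ a b, ContDiff ℝ n fun y => P y a b) (a b : Fin N) : ContDiff ℝ n fun y => (M y * P y) a b := by
  simp only [Matrix.mul_apply]
  exact ContDiff.sum fun c _ => (hM a c).mul (hP c b)

/-- Conjugate transposes, entrywise. [folklore] -/
theorem contDiff_entry_conjTranspose {E : Type*} [NormedAddCommGroup E] [NormedSpace ℝ E] {N : ℕ} {n : WithTop ℕ∞}
    {M : E → Matrix (Fin N) (Fin N) ℂ} (hM : ∀ a b, ContDiff ℝ n fun y => M y a b) (a b : Fin N) :
    ContDiff ℝ n fun y => (M y)ᴴ a b := by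
  have h : (fun y => (M y)ᴴ a b) = fun y => Complex.conjCLE (M y b a) := by
    funext y; simp [Matrix.conjTranspose_apply]
  rw [h]
  exact Complex.conjCLE.contDiff.comp (hM b a)

/-- `Re tr`, from the entries. [folklore] -/
theorem contDiff_re_trace {E : Type*} [NormedAddCommGroup E] [NormedSpace ℝ E] {N : ℕ} {n : WithTop ℕ∞}
    {M : E → Matrix (Fin N) (Fin N) ℂ} (hM : ∀ a b, ContDiff ℝ n fun y => M y a b) :
    ContDiff ℝ n fun y => ((M y).trace).re := by
  refine Complex.reCLM.contDiff.comp ?_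
  simp only [Matrix.trace, Matrix.diag]
  exact ContDiff.sum fun a _ => hM a a

/-- **The plaquette function is smooth in the real link coordinates.** [folklore] -/
theorem contDiff_psiHat {d L N : ℕ} [NeZero L] {n : WithTop ℕ∞} (β : ℝ) :
    ContDiff ℝ n fun y : Edge d L × Fin N × Fin N × Bool → ℝ =>
      β * ∑ p : Plaquette d L, (rootedLoop (fun (e : Edge d L) (i j : Fin N) =>
        ((y (e, i, j, false) : ℝ) : ℂ) + ((y (e, i, j, true) : ℝ) : ℂ) * Complex.I) (p.1, p.2.1.1) p.2.1.2 false).trace.re := by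
  refine contDiff_const.mul (ContDiff.sum fun p _ => ?_)
  simp only [rootedLoop]
  have hR : ∀ (e : Edge d L) (a b : Fin N), ContDiff ℝ n fun y : Edge d L × Fin N × Fin N × Bool → ℝ =>
      (fun (e : Edge d L) (i j : Fin N) => ((y (e, i, j, false) : ℝ) : ℂ) + ((y (e, i, j, true) : ℝ) : ℂ) * Complex.I) e a b :=
    fun e a b => contDiff_entry_rebuild e a b
  exact contDiff_re_trace (contDiff_entry_mul (contDiff_entry_mul (contDiff_entry_mul (hR _) (hR _))
    (contDiff_entry_conjTranspose (hR _))) (contDiff_entry_conjTranspose (hR _)))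

/-! ### The derivative of `ψ̂` along the noise fields -/

/-- Chain rule along a line: `s ↦ ψ̂(y + s v)` has derivative `Dψ̂(y)[v]` at `0` for differentiable `ψ̂`. [folklore] -/
theorem hasDerivAt_line_of_differentiable {E : Type*} [NormedAddCommGroup E] [NormedSpace ℝ E] {g : E → ℝ}
    (hg : Differentiable ℝ g) (y v : E) :
    HasDerivAt (fun s : ℝ => g (y + s • v)) (fderiv ℝ g y v) 0 := by
  have hline : HasDerivAt (fun s : ℝ => y + s • v) v 0 := by
    have h := ((hasDerivAt_id (0 : ℝ)).smul_const v).const_add y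
    simpa using h
  have hg' : HasFDerivAt g (fderiv ℝ g y) (y + (0 : ℝ) • v) := by
    rw [zero_smul, add_zero]; exact (hg y).hasFDerivAt
  exact hg'.comp_hasDerivAt (0 : ℝ) hline

/-- **The derivative of `ψ̂` at `flat Q` in the direction of the coordinates of `δ_e(A Q_e)`**, `A` skew-Hermitian:
`Dψ̂(flat Q)[flat δ_e(A Q_e)] = β Σ_{j ≠ e.2} Σ_b Re tr(A · rootedLoop Q e j b)`. [cite: ShenZhuZhu2022, §3 Lemma 3.1] -/
theorem fderiv_psiHat_flat_single {d L N : ℕ} [NeZero L] (β : ℝ) (Q : MatrixConfig d L N) (e : Edge d L)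
    {A : Matrix (Fin N) (Fin N) ℂ} (hA : Aᴴ = -A) :
    fderiv ℝ (fun y : Edge d L × Fin N × Fin N × Bool → ℝ =>
      β * ∑ p : Plaquette d L, (rootedLoop (fun (e : Edge d L) (i j : Fin N) =>
        ((y (e, i, j, false) : ℝ) : ℂ) + ((y (e, i, j, true) : ℝ) : ℂ) * Complex.I) (p.1, p.2.1.1) p.2.1.2 false).trace.re)
      (fun q : Edge d L × Fin N × Fin N × Bool => (fun z : ℂ => if q.2.2.2 then z.im else z.re) (Q q.1 q.2.1 q.2.2.1))
      (fun q : Edge d L × Fin N × Fin N × Bool => (fun z : ℂ => if q.2.2.2 then z.im else z.re)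
        ((Pi.single e (A * Q e) : MatrixConfig d L N) q.1 q.2.1 q.2.2.1)) =
      β * ∑ j ∈ univ.erase e.2, ∑ b : Bool, (A * rootedLoop Q e j b).trace.re := by
  set ψh : (Edge d L × Fin N × Fin N × Bool → ℝ) → ℝ := fun y =>
      β * ∑ p : Plaquette d L, (rootedLoop (fun (e : Edge d L) (i j : Fin N) =>
        ((y (e, i, j, false) : ℝ) : ℂ) + ((y (e, i, j, true) : ℝ) : ℂ) * Complex.I) (p.1, p.2.1.1) p.2.1.2 false).trace.re
    with hψh
  set y₀ : Edge d L × Fin N × Fin N × Bool → ℝ := fun q => (fun z : ℂ => if q.2.2.2 then z.im else z.re)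
    (Q q.1 q.2.1 q.2.2.1) with hy₀
  set v : Edge d L × Fin N × Fin N × Bool → ℝ := fun q => (fun z : ℂ => if q.2.2.2 then z.im else z.re)
    ((Pi.single e (A * Q e) : MatrixConfig d L N) q.1 q.2.1 q.2.2.1) with hv
  have hdiff : Differentiable ℝ ψh := (contDiff_psiHat (d := d) (L := L) (N := N) (n := 1) β).differentiable one_ne_zero
  -- the line derivative two ways
  have h1 : HasDerivAt (fun s : ℝ => ψh (y₀ + s • v)) (fderiv ℝ ψh y₀ v) 0 := hasDerivAt_line_of_differentiable hdiff y₀ v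
  have hR : ∀ s : ℝ, (fun (e' : Edge d L) (i j : Fin N) => (((y₀ + s • v) (e', i, j, false) : ℝ) : ℂ) +
      (((y₀ + s • v) (e', i, j, true) : ℝ) : ℂ) * Complex.I) =
      fun e' => Q e' + (s : ℂ) • (Pi.single e (A * Q e) : MatrixConfig d L N) e' := by
    intro s
    funext e' i j
    apply Complex.ext
    · simp [hy₀, hv, Complex.add_re, Complex.mul_re]
    · simp [hy₀, hv, Complex.add_im, Complex.mul_im]
  have hline : ∀ s : ℝ, ψh (y₀ + s • v) = β * ∑ p : Plaquette d L,
      (rootedLoop (fun e' => Q e' + (s : ℂ) • (Pi.single e (A * Q e) : MatrixConfig d L N) e')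
        (p.1, p.2.1.1) p.2.1.2 false).trace.re := by
    intro s
    rw [← hR s]
  have h2 : HasDerivAt (fun s : ℝ => ψh (y₀ + s • v)) (β * ∑ j ∈ univ.erase e.2, ∑ b : Bool,
      (A * rootedLoop Q e j b).trace.re) 0 := by
    have h := (hasDerivAt_sum_re_trace_plaquette Q e hA).const_mul β
    refine h.congr_of_eventuallyEq (Filter.Eventually.of_forall fun s => hline s)
  exact h1.unique h2

end Summit.QuantumFields.YangMills.Theorems.ColdStartUniversality

end
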